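import Mathlib
import HarnessLib
import HarnessLib.Audit
import Summits.CriticalPhenomena.Statement
import Summits.CriticalPhenomena.PercolationContinuityZ3.Theses.PercBudgetLadder

/-! Strategist s2 sketch: the two children of the split of `BudgetTightness`, typed exactly as the gate will
render them in the route file (fully-qualified bodies, route-file `open`s), and the check that the landed-to-be
glue `BudgetTightness_of_subs` (work/PercBudgetLadderBudgetTightnessSplit.lean, here re-proved inline as
`glue_inline` to keep this sketch self-contained) closes `NonProliferation → FewClustersCutTight → BudgetTightness`
by `exact` through the `def`s. -/

namespace Summit.CriticalPhenomena.PercolationContinuityZ3.Theses.PercBudgetLadder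

open scoped BigOperators Topology Manifold Classical MeasureTheory ProbabilityTheory Matrix InnerProductSpace ComplexConjugate ContinuousMap
open Filter Set Function TopologicalSpace MeasureTheory

/-- child 1 (VERBATIM stmt-CriticalPhenomena-4444 `PercNonProliferation.NonProliferation`). -/
def NonProliferation : Prop :=
  ∃ (M : ℕ) (c : ℝ), 0 < c ∧ ∃ᶠ n : ℕ in Filter.atTop, c ≤ (Literature.Probability.Percolation.bondPercolation (Literature.Probability.LatticeModels.zdGraph 3) (Literature.Probability.Percolation.criticalProbI 3)).real {ω | ¬ ∃ x : Fin (M + 1) → Literature.Probability.LatticeModels.Site 3, (∀ i, x i ∈ Literature.Probability.LatticeModels.box 3 n) ∧ (∀ i, ∃ y ∈ Literature.Probability.LatticeModels.innerBoundary (Literature.Probability.LatticeModels.zdGraph 3) (Literature.Probability.LatticeModels.box 3 (2 * n)), ω ∈ Literature.Probability.Percolation.openConnIn ↑(Literature.Probability.LatticeModels.box 3 (2 * n)) (x i) y) ∧ ∀ i j, i ≠ j → ω ∉ Literature.Probability.Percolation.openConnIn ↑(Literature.Probability.LatticeModels.box 3 (2 * n)) (x i) (x j)}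

/-- child 2 (new): tightness of the critical blocking budget on the few-clusters event, uniformly in n. -/
def FewClustersCutTight : Prop :=
  ∀ (M : ℕ) (ε : ℝ), 0 < ε → ∃ K : ℕ, ∀ᶠ n : ℕ in Filter.atTop, (Literature.Probability.Percolation.bondPercolation (Literature.Probability.LatticeModels.zdGraph 3) (Literature.Probability.Percolation.criticalProbI 3)).real {ω | (¬ ∃ x : Fin (M + 1) → Literature.Probability.LatticeModels.Site 3, (∀ i, x i ∈ Literature.Probability.LatticeModels.box 3 n) ∧ (∀ i, ∃ y ∈ Literature.Probability.LatticeModels.innerBoundary (Literature.Probability.LatticeModels.zdGraph 3) (Literature.Probability.LatticeModels.box 3 (2 * n)), ω ∈ Literature.Probability.Percolation.openConnIn ↑(Literature.Probability.LatticeModels.box 3 (2 * n)) (x i) y) ∧ ∀ i j, i ≠ j → ω ∉ Literature.Probability.Percolation.openConnIn ↑(Literature.Probability.LatticeModels.box 3 (2 * n)) (x i) (x j)) ∧ ¬ ∃ S : Finset (Sym2 (Literature.Probability.LatticeModels.Site 3)), S.card ≤ K ∧ ¬ ∃ x ∈ Literature.Probability.LatticeModels.box 3 n, ∃ y ∈ Literature.Probability.LatticeModels.innerBoundary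 (Literature.Probability.LatticeModels.zdGraph 3) (Literature.Probability.LatticeModels.box 3 (2 * n)), (ω \ ↑S) ∈ Literature.Probability.Percolation.openConnIn ↑(Literature.Probability.LatticeModels.box 3 (2 * n)) x y} ≤ ε

/-- the glue with bodies inlined, exactly as in work/PercBudgetLadderBudgetTightnessSplit.lean -/
theorem glue_inline :
    (∃ (M : ℕ) (c : ℝ), 0 < c ∧ ∃ᶠ n : ℕ in Filter.atTop, c ≤
      (Literature.Probability.Percolation.bondPercolation (Literature.Probability.LatticeModels.zdGraph 3) (Literature.Probability.Percolation.criticalProbI 3)).real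
        {ω | ¬ ∃ x : Fin (M + 1) → Literature.Probability.LatticeModels.Site 3, (∀ i, x i ∈ Literature.Probability.LatticeModels.box 3 n) ∧
          (∀ i, ∃ y ∈ Literature.Probability.LatticeModels.innerBoundary (Literature.Probability.LatticeModels.zdGraph 3) (Literature.Probability.LatticeModels.box 3 (2 * n)),
            ω ∈ Literature.Probability.Percolation.openConnIn ↑(Literature.Probability.LatticeModels.box 3 (2 * n)) (x i) y) ∧
          ∀ i j, i ≠ j → ω ∉ Literature.Probability.Percolation.openConnIn ↑(Literature.Probability.LatticeModels.box 3 (2 * n)) (x i) (x j)}) →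
    (∀ (M : ℕ) (ε : ℝ), 0 < ε → ∃ K : ℕ, ∀ᶠ n : ℕ in Filter.atTop,
      (Literature.Probability.Percolation.bondPercolation (Literature.Probability.LatticeModels.zdGraph 3) (Literature.Probability.Percolation.criticalProbI 3)).real
        {ω | (¬ ∃ x : Fin (M + 1) → Literature.Probability.LatticeModels.Site 3, (∀ i, x i ∈ Literature.Probability.LatticeModels.box 3 n) ∧
            (∀ i, ∃ y ∈ Literature.Probability.LatticeModels.innerBoundary (Literature.Probability.LatticeModels.zdGraph 3) (Literature.Probability.LatticeModels.box 3 (2 * n)),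
              ω ∈ Literature.Probability.Percolation.openConnIn ↑(Literature.Probability.LatticeModels.box 3 (2 * n)) (x i) y) ∧
            ∀ i j, i ≠ j → ω ∉ Literature.Probability.Percolation.openConnIn ↑(Literature.Probability.LatticeModels.box 3 (2 * n)) (x i) (x j)) ∧
          ¬ ∃ S : Finset (Sym2 (Literature.Probability.LatticeModels.Site 3)), S.card ≤ K ∧
            ¬ ∃ x ∈ Literature.Probability.LatticeModels.box 3 n, ∃ y ∈ Literature.Probability.LatticeModels.innerBoundary (Literature.Probability.LatticeModels.zdGraph 3) (Literature.Probability.LatticeModels.box 3 (2 * n)),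
              (ω \ ↑S) ∈ Literature.Probability.Percolation.openConnIn ↑(Literature.Probability.LatticeModels.box 3 (2 * n)) x y} ≤ ε) →
    BudgetTightness := by
  rintro ⟨M, c, hc, hfreq⟩ hT
  obtain ⟨K, hK⟩ := hT M (c / 2) (by positivity)
  refine ⟨K, 2, c / 2, le_rfl, by positivity, fun N => ?_⟩
  obtain ⟨n, hcn, hNn, hbad⟩ := (hfreq.and_eventually ((eventually_ge_atTop N).and hK)).exists
  refine ⟨n, hNn, ?_⟩
  have hsub : {ω : Set (Sym2 (Literature.Probability.LatticeModels.Site 3)) | ¬ ∃ x : Fin (M + 1) → Literature.Probability.LatticeModels.Site 3, (∀ i, x i ∈ Literature.Probability.LatticeModels.box 3 n) ∧ (∀ i, ∃ y ∈ Literature.Probability.LatticeModels.innerBoundary (Literature.Probability.LatticeModels.zdGraph 3) (Literature.Probability.LatticeModels.box 3 (2 * n)), ω ∈ Literature.Probability.Percolation.openConnIn ↑(Literature.Probability.LatticeModels.box 3 (2 * n)) (x i) y) ∧ ∀ i j, i ≠ j → ω ∉ Literature.Probability.Percolation.openConnIn ↑(Literature.Probability.LatticeModels.box 3 (2 * n))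 (x i) (x j)} ⊆ {ω : Set (Sym2 (Literature.Probability.LatticeModels.Site 3)) | ∃ S : Finset (Sym2 (Literature.Probability.LatticeModels.Site 3)), S.card ≤ K ∧ ¬ ∃ x ∈ Literature.Probability.LatticeModels.box 3 n, ∃ y ∈ Literature.Probability.LatticeModels.innerBoundary (Literature.Probability.LatticeModels.zdGraph 3) (Literature.Probability.LatticeModels.box 3 (2 * n)), (ω \ ↑S) ∈ Literature.Probability.Percolation.openConnIn ↑(Literature.Probability.LatticeModels.box 3 (2 * n)) x y} ∪ {ω : Set (Sym2 (Literature.Probability.LatticeModels.Site 3)) | (¬ ∃ x : Fin (M + 1) → Literature.Probability.LatticeModels.Site 3, (∀ i, x i ∈ Literature.Probability.LatticeModels.box 3 n) ∧ (∀ i, ∃ y ∈ Literature.Probability.LatticeModels.innerBoundary (Literature.Probability.LatticeModels.zdGraph 3) (Literature.Probability.LatticeModels.box 3 (2 * n)), ω ∈ Literature.Probability.Percolation.openConnIn ↑(Literature.Probability.LatticeModels.box 3 (2 * n)) (x i) y) ∧ ∀ i j, i ≠ j → ω ∉ Literature.Probability.Percolation.openConnIn ↑(Literature.Probability.LatticeModels.box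 3 (2 * n)) (x i) (x j)) ∧ ¬ ∃ S : Finset (Sym2 (Literature.Probability.LatticeModels.Site 3)), S.card ≤ K ∧ ¬ ∃ x ∈ Literature.Probability.LatticeModels.box 3 n, ∃ y ∈ Literature.Probability.LatticeModels.innerBoundary (Literature.Probability.LatticeModels.zdGraph 3) (Literature.Probability.LatticeModels.box 3 (2 * n)), (ω \ ↑S) ∈ Literature.Probability.Percolation.openConnIn ↑(Literature.Probability.LatticeModels.box 3 (2 * n)) x y} := by
    intro ω hω
    by_cases hG : ω ∈ {ω : Set (Sym2 (Literature.Probability.LatticeModels.Site 3)) | ∃ S : Finset (Sym2 (Literature.Probability.LatticeModels.Site 3)), S.card ≤ K ∧ ¬ ∃ x ∈ Literature.Probability.LatticeModels.box 3 n, ∃ y ∈ Literature.Probability.LatticeModels.innerBoundary (Literature.Probability.LatticeModels.zdGraph 3) (Literature.Probability.LatticeModels.box 3 (2 * n)), (ω \ ↑S) ∈ Literature.Probability.Percolation.openConnIn ↑(Literature.Probability.LatticeModels.box 3 (2 * n)) x y}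
    · exact Or.inl hG
    · exact Or.inr ⟨hω, hG⟩
  have h1 := (measureReal_mono hsub (measure_ne_top (Literature.Probability.Percolation.bondPercolation (Literature.Probability.LatticeModels.zdGraph 3) (Literature.Probability.Percolation.criticalProbI 3)) _)).trans (measureReal_union_le _ _)
  linarith

/-- THE CHECK: through the `def`s, by `exact`. -/
theorem BudgetTightness_of_children : NonProliferation → FewClustersCutTight → BudgetTightness := by
  exact glue_inline

/-- and by term-mode application (what `--glue-by` amounts to). -/
theorem BudgetTightness_of_children' : NonProliferation → FewClustersCutTight → BudgetTightness :=
  glue_inline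

/-- sanity: child 2 at `M = 0` is trivial (on the no-crossing event the budget-0 set `S = ∅` blocks), so the
content sits at `M ≥ 1`; recorded for the vacuity audit. -/
example : ∀ (ε : ℝ), 0 < ε → ∃ K : ℕ, ∀ᶠ n : ℕ in Filter.atTop, (Literature.Probability.Percolation.bondPercolation (Literature.Probability.LatticeModels.zdGraph 3) (Literature.Probability.Percolation.criticalProbI 3)).real {ω | (¬ ∃ x : Fin (0 + 1) → Literature.Probability.LatticeModels.Site 3, (∀ i, x i ∈ Literature.Probability.LatticeModels.box 3 n) ∧ (∀ i, ∃ y ∈ Literature.Probability.LatticeModels.innerBoundary (Literature.Probability.LatticeModels.zdGraph 3) (Literature.Probability.LatticeModels.box 3 (2 * n)), ω ∈ Literature.Probability.Percolation.openConnIn ↑(Literature.Probability.LatticeModels.box 3 (2 * n)) (x i) y) ∧ ∀ i j, i ≠ j → ω ∉ Literature.Probability.Percolation.openConnIn ↑(Literature.Probability.LatticeModels.box 3 (2 * n)) (x i) (x j)) ∧ ¬ ∃ S : Finset (Sym2 (Literature.Probability.LatticeModels.Site 3)), S.card ≤ K ∧ ¬ ∃ x ∈ Literature.Probability.LatticeModels.box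 3 n, ∃ y ∈ Literature.Probability.LatticeModels.innerBoundary (Literature.Probability.LatticeModels.zdGraph 3) (Literature.Probability.LatticeModels.box 3 (2 * n)), (ω \ ↑S) ∈ Literature.Probability.Percolation.openConnIn ↑(Literature.Probability.LatticeModels.box 3 (2 * n)) x y} ≤ ε := by
  intro ε hε
  refine ⟨0, Filter.Eventually.of_forall fun n => ?_⟩
  have hempty : {ω : Set (Sym2 (Literature.Probability.LatticeModels.Site 3)) | (¬ ∃ x : Fin (0 + 1) → Literature.Probability.LatticeModels.Site 3, (∀ i, x i ∈ Literature.Probability.LatticeModels.box 3 n) ∧ (∀ i, ∃ y ∈ Literature.Probability.LatticeModels.innerBoundary (Literature.Probability.LatticeModels.zdGraph 3) (Literature.Probability.LatticeModels.box 3 (2 * n)), ω ∈ Literature.Probability.Percolation.openConnIn ↑(Literature.Probability.LatticeModels.box 3 (2 * n)) (x i) y) ∧ ∀ i j, i ≠ j → ω ∉ Literature.Probability.Percolation.openConnIn ↑(Literature.Probability.LatticeModels.box 3 (2 * n)) (x i) (x j)) ∧ ¬ ∃ S : Finset (Sym2 (Literature.Probability.LatticeModels.Site 3)), S.card ≤ 0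 ∧ ¬ ∃ x ∈ Literature.Probability.LatticeModels.box 3 n, ∃ y ∈ Literature.Probability.LatticeModels.innerBoundary (Literature.Probability.LatticeModels.zdGraph 3) (Literature.Probability.LatticeModels.box 3 (2 * n)), (ω \ ↑S) ∈ Literature.Probability.Percolation.openConnIn ↑(Literature.Probability.LatticeModels.box 3 (2 * n)) x y} = ∅ := by
    ext ω
    simp only [Set.mem_setOf_eq, Set.mem_empty_iff_false, iff_false, not_and, not_not]
    intro hno
    refine ⟨∅, by simp, ?_⟩
    rintro ⟨x, hx, y, hy, hxy⟩
    apply hno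
    refine ⟨fun _ => x, fun _ => hx, fun _ => ⟨y, hy, by simpa using hxy⟩, fun i j hij => absurd (Fin.ext (by have := i.isLt; have := j.isLt; omega)) hij⟩
  rw [hempty]
  simp [hε.le]

end Summit.CriticalPhenomena.PercolationContinuityZ3.Theses.PercBudgetLadder
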